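import Summits.QuantumFields.YangMills.Theorems.AllWindowsColdBoxBoxKernelHessianDecay
import Summits.QuantumFields.YangMills.Theorems.AllWindowsColdBoxTorusGreenSizeDecay

/-!
# `(1 + dist_∞)⁻²` size bound for the Dirichlet/Neumann box Green function in `d = 4`
# ((J′1) of STUB-PLAN-U1 rev 2 §6.3 / K1-T companion: LINE-18 stub K1 ⟨stmt-QuantumFields-24006⟩, LINE-19/20 S3b–U1 ⟨24004⟩/⟨24336⟩)

The 16-image formula `G_B = boxLap⁻¹ = ½ Σ_σ sgn(σ) G̃_{2M}(ι· − σ·ι·)` (`…BoxKernelGreen`) and the torus size bound `torusGreen_size_le` give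
* **`boxGreen_size_decay`** — an absolute `C` with `|G_B(s, s')|·(1 + |s_κ − s'_κ|)² ≤ C` for all half-periods `M ≥ 1`, Dirichlet sets, coordinates `κ` and
  box points `s, s'`;
* **`boxLap_inv_size_decay`** — the same for the entries of `boxLap⁻¹` (nonempty Dirichlet set): `|L⁻¹(z, z')| ≤ C (1 + |z − z'|_∞)^{−2}` uniformly in
  the box, UP TO THE WALL.
Together with `…BoxKernelGradientDecay` and `…BoxKernelHessianDecay` this is the full scalar kernel package (size `−2`, gradient `−3`, Hessian `−4`) of
every D/N box problem.  No definitions; standard axioms.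

HONEST LABEL: helper toward the OPEN kernel stubs K1 / S3b / U1 of critic-passed lines on the R2ξ″ RECORD-rung cruxes 24006 / 24004 / 24336; no stub, crux,
rung or summit is proved here; the Yang–Mills mass gap is NOT proved by this file.
-/

set_option autoImplicit false

noncomputable section

open Finset ZMod
open scoped Real BigOperators

namespace Summit.QuantumFields.YangMills.Theorems.AllWindowsColdBox.BoxKernel

open Literature.Probability.LatticeModels

variable {d : ℕ} {M : ℕ} [NeZero M] {Dset : Finset (Fin d)}

/-- The box Green function as the image sum, unfolded. -/
theorem boxGreen_eq_sum (y y' : Fin d → ℤ) :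
    boxGreen M Dset y y' = (1 / 2 : ℝ) * ∑ σ : Fin d → Bool, sgn Dset σ * torusGreen (toTorus M y - refl M Dset σ (toTorus M y')) := rfl

/-- Per-image bound: if the `κ`-coordinate of `z` is the class of `y_κ − r` (`r` one of the three images of `y'_κ`), then
`|G̃(z)|·(1 + |y_κ − y'_κ|)² ≤ 9 C₁`, `C₁` the constant of `torusGreen_size_le`. -/
theorem torusGreen_size_image_le {C₁ : ℝ}
    (hG : ∀ (L : ℕ) [NeZero L], 2 ≤ L → ∀ (z : TorusSite 4 L),
      |torusGreen z| * (max 1 (Real.sqrt (∑ k, (((z k).valMinAbs : ℤ) : ℝ) ^ 2))) ^ 2 ≤ C₁)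
    {M : ℕ} [NeZero M] {Dset : Finset (Fin 4)} (s s' : Box 4 M Dset) (κ : Fin 4) (σ : Fin 4 → Bool) (z : TorusSite 4 (2 * M))
    (hz : z κ = (((coords s κ - (if σ κ then (if κ ∈ Dset then -coords s' κ else -1 - coords s' κ) else coords s' κ) : ℤ)) :
      ZMod (2 * M))) :
    |torusGreen z| * (1 + |(((s.1 κ : ℕ) : ℝ)) - ((s'.1 κ : ℕ) : ℝ)|) ^ 2 ≤ 9 * C₁ := by
  set n : ℝ := |(((s.1 κ : ℕ) : ℝ)) - ((s'.1 κ : ℕ) : ℝ)| with hn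
  have hL : 2 ≤ 2 * M := by have := Nat.pos_of_ne_zero (NeZero.ne M); omega
  have hnint : n = (( |coords s κ - coords s' κ| : ℤ) : ℝ) := by rw [hn]; simp [coords]
  have hs0 : 0 ≤ coords s κ := by simp [coords]
  have hsM : coords s κ < M := by simp only [coords]; exact_mod_cast (s.1 κ).isLt
  have hs0' : 0 ≤ coords s' κ := by simp [coords]
  have hsM' : coords s' κ < M := by simp only [coords]; exact_mod_cast (s'.1 κ).isLt
  have hGz := hG (2 * M) hL z
  have hfar : (( |coords s κ - coords s' κ| : ℤ) : ℝ) - 1 ≤ Real.sqrt (∑ k, (((z k).valMinAbs : ℤ) : ℝ) ^ 2) := by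
    refine le_trans ?_ (abs_valMinAbs_le_dist z κ)
    rw [hz, ← Int.cast_one, ← Int.cast_sub, ← Int.cast_abs, Int.cast_le]
    refine le_abs_valMinAbs_of_forall (2 * M) _ _ fun j => ?_
    have hm : (coords s κ - (if σ κ then (if κ ∈ Dset then -coords s' κ else -1 - coords s' κ) else coords s' κ)) = coords s κ - coords s' κ ∨
        (coords s κ - (if σ κ then (if κ ∈ Dset then -coords s' κ else -1 - coords s' κ) else coords s' κ)) = coords s κ + coords s' κ ∨
        (coords s κ - (if σ κ then (if κ ∈ Dset then -coords s' κ else -1 - coords s' κ) else coords s' κ)) = coords s κ + coords s' κ + 1 := by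
      split_ifs
      · right; left; ring
      · right; right; ring
      · left; rfl
    have h := repr_bound (δ := 0) hs0 hsM hs0' hsM' (by norm_num) zero_le_one hm j
    rwa [add_zero] at h
  rw [← hnint] at hfar
  have hmax : 1 + n ≤ 3 * max 1 (Real.sqrt (∑ k, (((z k).valMinAbs : ℤ) : ℝ) ^ 2)) := by
    rcases le_or_gt 2 n with h2 | h2
    · calc 1 + n ≤ 3 * (n - 1) := by linarith
        _ ≤ 3 * max 1 (Real.sqrt (∑ k, (((z k).valMinAbs : ℤ) : ℝ) ^ 2)) :=
            mul_le_mul_of_nonneg_left (hfar.trans (le_max_right _ _)) (by norm_num)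
    · have hn0 : 0 ≤ n := abs_nonneg _
      calc 1 + n ≤ 3 * 1 := by linarith
        _ ≤ 3 * max 1 (Real.sqrt (∑ k, (((z k).valMinAbs : ℤ) : ℝ) ^ 2)) :=
            mul_le_mul_of_nonneg_left (le_max_left _ _) (by norm_num)
  have hn0 : 0 ≤ n := abs_nonneg _
  have hpow : (1 + n) ^ 2 ≤ 9 * (max 1 (Real.sqrt (∑ k, (((z k).valMinAbs : ℤ) : ℝ) ^ 2))) ^ 2 := by
    calc (1 + n) ^ 2 ≤ (3 * max 1 (Real.sqrt (∑ k, (((z k).valMinAbs : ℤ) : ℝ) ^ 2))) ^ 2 := pow_le_pow_left₀ (by linarith) hmax 2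
      _ = 9 * (max 1 (Real.sqrt (∑ k, (((z k).valMinAbs : ℤ) : ℝ) ^ 2))) ^ 2 := by ring
  calc |torusGreen z| * (1 + n) ^ 2 ≤ |torusGreen z| * (9 * (max 1 (Real.sqrt (∑ k, (((z k).valMinAbs : ℤ) : ℝ) ^ 2))) ^ 2) :=
        mul_le_mul_of_nonneg_left hpow (abs_nonneg _)
    _ = 9 * (|torusGreen z| * (max 1 (Real.sqrt (∑ k, (((z k).valMinAbs : ℤ) : ℝ) ^ 2))) ^ 2) := by ring
    _ ≤ 9 * C₁ := mul_le_mul_of_nonneg_left hGz (by norm_num)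

/-- **Size bound for the box Green function**: `|G_B(s, s')|·(1 + |s_κ − s'_κ|)² ≤ C`, uniformly in the box. -/
theorem boxGreen_size_decay : ∃ C : ℝ, 0 ≤ C ∧ ∀ (M : ℕ) [NeZero M] (Dset : Finset (Fin 4)) (κ : Fin 4) (s s' : Box 4 M Dset),
    |boxGreen M Dset (coords s) (coords s')| * (1 + |(((s.1 κ : ℕ) : ℝ)) - ((s'.1 κ : ℕ) : ℝ)|) ^ 2 ≤ C := by
  obtain ⟨C₁, hC₁0, hG⟩ := torusGreen_size_le
  refine ⟨72 * C₁, by positivity, ?_⟩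
  intro M _ Dset κ s s'
  set n : ℝ := |(((s.1 κ : ℕ) : ℝ)) - ((s'.1 κ : ℕ) : ℝ)| with hn
  rw [boxGreen_eq_sum]
  set T : (Fin 4 → Bool) → ℝ := fun σ => torusGreen (toTorus M (coords s) - refl M Dset σ (toTorus M (coords s'))) with hT
  have hTσ : ∀ σ : Fin 4 → Bool, |T σ| * (1 + n) ^ 2 ≤ 9 * C₁ := by
    intro σ
    refine torusGreen_size_image_le hG s s' κ σ _ ?_
    rw [sub_refl_apply]
  have h12 : (0 : ℝ) < 1 / 2 := by norm_num
  calc |(1 / 2 : ℝ) * ∑ σ : Fin 4 → Bool, sgn Dset σ * T σ| * (1 + n) ^ 2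
        = (1 / 2 : ℝ) * (|∑ σ : Fin 4 → Bool, sgn Dset σ * T σ| * (1 + n) ^ 2) := by rw [abs_mul, abs_of_pos h12, mul_assoc]
    _ ≤ (1 / 2 : ℝ) * ((∑ σ : Fin 4 → Bool, |sgn Dset σ * T σ|) * (1 + n) ^ 2) :=
        mul_le_mul_of_nonneg_left (mul_le_mul_of_nonneg_right (Finset.abs_sum_le_sum_abs _ _) (by positivity)) h12.le
    _ = (1 / 2 : ℝ) * ∑ σ : Fin 4 → Bool, |T σ| * (1 + n) ^ 2 := by
        rw [Finset.sum_mul]; congr 1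
        exact Finset.sum_congr rfl fun σ _ => by rw [abs_mul, abs_sgn, one_mul]
    _ ≤ (1 / 2 : ℝ) * ∑ σ : Fin 4 → Bool, (9 * C₁ : ℝ) := mul_le_mul_of_nonneg_left (Finset.sum_le_sum fun σ _ => hTσ σ) h12.le
    _ = 72 * C₁ := by
        rw [Finset.sum_const, Finset.card_univ, Fintype.card_fun, Fintype.card_bool, Fintype.card_fin, nsmul_eq_mul]
        push_cast; ring

/-- **Size bound for `boxLap⁻¹`** (nonempty Dirichlet set): `|L⁻¹(s, s')|·(1 + |s_κ − s'_κ|)² ≤ C` for all box points and coordinates. -/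
theorem boxLap_inv_size_decay : ∃ C : ℝ, 0 ≤ C ∧ ∀ (M : ℕ) [NeZero M] (Dset : Finset (Fin 4)), Dset.Nonempty →
    ∀ (κ : Fin 4) (s s' : Box 4 M Dset),
    |(boxLap M Dset)⁻¹ s s'| * (1 + |(((s.1 κ : ℕ) : ℝ)) - ((s'.1 κ : ℕ) : ℝ)|) ^ 2 ≤ C := by
  obtain ⟨C, hC0, hC⟩ := boxGreen_size_decay
  refine ⟨C, hC0, ?_⟩
  intro M _ Dset hD κ s s'
  rw [boxLap_inv_eq hD]
  simp only [boxGreenMat, Matrix.of_apply]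
  exact hC M Dset κ s s'

end Summit.QuantumFields.YangMills.Theorems.AllWindowsColdBox.BoxKernel

end
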